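import Literature.MathematicalPhysics.QuantumFieldTheory.Balaban1983to89.B5G183RateO2Diag
import Literature.MathematicalPhysics.QuantumFieldTheory.Balaban1983to89.B5G183RateL2Asm

/-!
# Bałaban [CMP 95 (1984)] (1.83)/(1.89) at `U = 1`, ORDER TWO: the OPERATOR-level eta-rate of
`∇_ν G ∇_{ν′}^*` HOLDS in a King-weighted currency (two alias weights (4.20) on one derivative) — by soft
operator algebra from the order-one rate; the positive operator-level counterpart of the no-go
`B5G183RateObstructionOp.not_orderTwoOpRateResidual`

HONEST FRAMING (cell `pub-balaban`, T⁴ programme, estimate NE2 = U1a «η-rate, linear theory»).  Finite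
torus, lattice spacing `η = 1/n`, trivial background `U = 1`, a fixed NONZERO reduced momentum `p′ = s`
(one fibre at a time; `ℓ²`-operator norm on the alias classes `× Fin d`).  Nothing here is about infinite
volume, `U ≠ 1`, a mass gap, or any summit statement.  Bałaban prints NO rate; the alias weights are
KING's ([King1986] (4.20) p. 672: `|u(p′+l)| ≤ Π_μ |p′_μ| |p′_μ + l_μ|⁻¹`, in the tree as
`King1986.aliasWeight`); the currency (which factor carries how many weights), the pairing `ι`/`plant`
and every constant are OURS ([folklore]).

WHAT IS PRINTED.  [Balaban1984PropagatorsI] p. 33: «Proposition 1.1. The operator G is a symmetric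
operator on L²(T_η) and ‖GJ‖, ‖∇GJ‖, ‖G∇*J‖, ‖∇G∇*J‖, ‖∇∇GJ‖, ‖G∇*∇*J‖ ≤ γ₀⁻¹‖J‖, (1.89)»; p. 32: «It
is bounded also when differentiated two times at most.»  [King1986] p. 672: «To analyze the m = 0 term
in (4.19), we successively replace each factor by the corresponding one … and bound the error. We must
always be careful to keep enough negative powers of momentum so that» the sum over `l` is bounded
(p. 673, first line), with the legends (4.22) «≤ C for α < 1.» and (4.23) «≤ CL^{−γk} for α + γ < 1»,
and p. 673 (4.24) «≤ C|p′+l|^γ|x−x′|^γ ≤ CL^{−γk}|p′+l|^γ», «So keeping γ + α < 1, the error produced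
by the above replacement is bounded by CL^{−γk}.»  (renders ref1 p016/p017, king p024/p025 read as
images by this seat.)

WHAT THIS MODULE PROVES (kernel, [folklore], our constants).  `W = Wc n k s` is King's (4.20) weight of
the alias class `k` at the fibre `s` (`B5G183RateO2Diag.Wc`), `∂^{(n)}_ν = dSym n`, `D_w X D_{w′}^* =
sandwich w w′ X` (b05 = the sibling modules `B5Prop11Bound`/`B5Prop11Fiber`), `F_n = (balabanFiber n …).G`
the fibre matrix of `G(p′)` ((1.83), `B5Prop11Fiber`), `plant_R` the transport of a level-`N` operator to
level `RN` along King's pairing (`B5G183RateOp.plant`).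
 §1 sandwich algebra: `sandwich_peel_right/left` (`D_ℓ X D_r^* = D_1(D_ℓ X D_1^*)D_r^*`), the identity
    `sandwich_sub_sandwich` (`D_aYD_b^* − D_{a′}PD_{b′}^* = D_a(Y−P)D_b^* + D_aPD_{b−b′}^* + D_{a−a′}PD_{b′}^*`),
    `opNorm_sandwich_le` (`‖D_a X D_b^*‖ ≤ sup|a|·‖X‖·sup|b|`, `Matrix.l2_opNorm_mul` +
    `B5G183RateL2Op.opNorm_diagonal_le`) and the abstract rate `opNorm_sandwich_sub_sandwich_le`.
 §2 `plant_sandwich`: **planting commutes with sandwiching** for any level-`RN` weights extending the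
    level-`N` ones along `ι` (the planted operator vanishes on the unpaired classes); `extend` (extension
    BY the level-`RN` weight itself on the unpaired classes), `norm_sub_extend_le`.
 §3 the weighted symbol `wdSym n k s ν = W²·∂^{(n)}_ν(q̃_k)`: **`norm_wdSym_le : |W²∂| ≤ π`** uniformly
    (`B5G183RateO2Diag.Wc_sq_mul_norm_le`) and its own eta-rate on the paired classes
    **`wdSym_rate_le : |W²∂^{(RN)}(ιk) − W²∂^{(N)}(k)| ≤ 6π²/N`** (`Wc_iota`, `B5G183RateL2.dSym_rate_le`).
 §4 **`opNorm_D_G_DW_rate`: `‖D_{∂^{(RN)}_ν} F_{RN} D_{W²∂^{(RN)}_{ν′}}^* − plant_R(D_{∂^{(N)}_ν} F_N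
    D_{W²∂^{(N)}_{ν′}}^*)‖ ≤ C2op(d,a)/N`** for all `N, R ≥ 1`, `a > 0`, nonzero `p′` of the zone, `ν, ν′`,
    with `C2op = π·Casm + 6π²·(gamma0 + Casm)` — from the ORDER-ONE operator rate
    `B5G183RateL2Asm.orderOneOpRateResidualL_holds` (`Casm/N`), the uniform bound
    `B5Prop11Fiber.opNorm_D_G_le` (`gamma0`), §1–§3; the mirrored currency **`opNorm_DW_G_D_rate`**
    (`W²` on the left derivative; from `orderOneOpRateResidualR_holds`, `opNorm_G_D_le`); the uniform
    companion `opNorm_D_G_DW_le` (`≤ gamma0`, since `W² ≤ 1`: the weighted object keeps print's bound);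
    the typed statement `OrderTwoOpRateResidualW` (verbatim the binder shape of the REFUTED
    `B5G183RateObstructionOp.OrderTwoOpRateResidual` with the right weight `∂_{ν′}` replaced by `W²∂_{ν′}`)
    and **`orderTwoOpRateResidualW_holds : OrderTwoOpRateResidualW d a (C2op d a)`**; finally
    **`orderTwo_dichotomy`**: in `d ≥ 2`, `(¬ ∃ C, OrderTwoOpRateResidual d a C) ∧
    OrderTwoOpRateResidualW d a (C2op d a)` — ORDER TWO of (1.89) is DECIDED fibrewise in the
    `ℓ²`-operator norm: NO eta-rate with zero alias weights, the FULL rate `1/N` with two alias weights on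
    one derivative.
 §5 [v1.1] the ONE-SIDED order-two items of (1.89), `∇_ν∇_{ν′}G` and `G∇*_ν∇*_{ν′}`, in the currency
    `∂_ν·W²∂_{ν′}`: **`opNorm_DDW_G_rate`**, **`opNorm_G_DDW_rate`** (≤ C2op/N; `sandwich_mul_left/right` +
    the same soft algebra), and the packaging **`derivative_items_rate`**: all five derivative items of
    (1.89) carry an eta-rate at `U = 1` fibrewise (order one unweighted `Casm/N`, order two King-weighted
    `C2op/N`; the sixth item `G` itself is `B5G183RateOp.opNorm_G_rate`).
 §6 [v1.2] the REMAINING currency TYPED (not proved, not assumed): `w1dSym = W·∂` (ONE King weight per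
    derivative, King's `u … ū` placement), `norm_w1dSym_le` (≤ π), the uniform bound `opNorm_DW1_G_DW1_le`
    (≤ gamma0), the typed residual **`OrderTwoOpRateResidualW1 d a C γ`** (rate `C/N^γ`) with its exponent
    monotonicity — the exact missing inequality for the successor, with what is known about it listed in
    its docstring.
The mechanism is King's p. 672 «keep enough negative powers of momentum»: the one replacement that the
order-one rate does not already pay for is `∂^{(RN)}_{ν′} → ∂^{(N)}_{ν′}` on the far paired classes, of
size `6‖q̃‖²/N` (second-order Taylor), and `W²` supplies exactly the two negative powers (`W‖q̃‖_∞ ≤ π`,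
`B5G183RateO2Diag.aliasWeight_mul_norm_le`).

WHAT REMAINS / NOT CLAIMED: (i) the currency with ONE alias weight per derivative (`W∂_ν ⊗ W∂_{ν′}`,
King's own placement `u … ū` in (4.19); TYPED as `OrderTwoOpRateResidualW1`, §6, NOT proved) or with a
single weight in total at the OPERATOR level — its
free-diagonal piece has the full rate (`B5G183RateO2Diag.diag_weight2_rate_le`, `opNorm_Dg2_le`), the
finite-rank blocks with that placement are NOT estimated anywhere in this package, and soft algebra does
not reach it (one weight pays for one of the two momentum powers of `∂^{(RN)} − ∂^{(N)}`); (ii) the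
exponent trade `C/N^γ` with fewer weights (King's printed regime `α + γ < 1`); (iii) `p′`-derivatives,
`∫dp′`, position space, the exponential decay of Prop. 1.2 ((1.110)–(1.111) p. 35), `U ≠ 1`, optimal
constants; (iv) anything about print: the weighted statements are OURS.
-/

noncomputable section

namespace Literature.MathematicalPhysics.QuantumFieldTheory.Balaban1983to89.B5G183RateO2Op

open scoped BigOperators ComplexConjugate Matrix.Norms.L2Operator
open Finset Complex
open Literature.MathematicalPhysics.QuantumFieldTheory.Balaban1983to89.B4Strip
open Literature.MathematicalPhysics.QuantumFieldTheory.Balaban1983to89.B5Prop11Fiber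
open Literature.MathematicalPhysics.QuantumFieldTheory.Balaban1983to89.B5Prop11Bound
open Literature.MathematicalPhysics.QuantumFieldTheory.Balaban1983to89.B5Hk163Rate
open Literature.MathematicalPhysics.QuantumFieldTheory.Balaban1983to89.B5Hk163RateSum
open Literature.MathematicalPhysics.QuantumFieldTheory.Balaban1983to89.B5G183RateL2
open Literature.MathematicalPhysics.QuantumFieldTheory.Balaban1983to89.B5G183RateL2Op
open Literature.MathematicalPhysics.QuantumFieldTheory.Balaban1983to89.B5G183RateOp
open Literature.MathematicalPhysics.QuantumFieldTheory.Balaban1983to89.B5G183RateL2Asm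
open Literature.MathematicalPhysics.QuantumFieldTheory.Balaban1983to89.B5G183RateO2Diag
open Literature.MathematicalPhysics.QuantumFieldTheory.King1986

variable {d : ℕ}

/-! ## §1 Sandwich algebra and the operator norm of a sandwich [folklore] -/

section Algebra

variable {Λ : Type*}

/-- peeling the right weight off a sandwich: `D_ℓ X D_r^* = D_1 (D_ℓ X D_1^*) D_r^*`. [folklore] -/
theorem sandwich_peel_right (ℓ r : Λ → ℂ) (X : Matrix (Λ × Fin d) (Λ × Fin d) ℂ) :
    sandwich ℓ r X = sandwich (fun _ => (1 : ℂ)) r (sandwich ℓ (fun _ => (1 : ℂ)) X) := by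
  ext i j
  simp only [sandwich, map_one, mul_one, one_mul]

/-- peeling the left weight off a sandwich: `D_ℓ X D_r^* = D_ℓ (D_1 X D_r^*) D_1^*`. [folklore] -/
theorem sandwich_peel_left (ℓ r : Λ → ℂ) (X : Matrix (Λ × Fin d) (Λ × Fin d) ℂ) :
    sandwich ℓ r X = sandwich ℓ (fun _ => (1 : ℂ)) (sandwich (fun _ => (1 : ℂ)) r X) := by
  ext i j
  simp only [sandwich, map_one, mul_one, one_mul]
  ring

/-- the two-term resolvent-type identity behind every eta-rate of a sandwich:
`D_a Y D_b^* − D_a' P D_b'^* = D_a (Y − P) D_b^* + (D_{a} P D_{b−b'}^* + D_{a−a'} P D_{b'}^*)`. [folklore] -/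
theorem sandwich_sub_sandwich (a a' b b' : Λ → ℂ) (Y P : Matrix (Λ × Fin d) (Λ × Fin d) ℂ) :
    sandwich a b Y - sandwich a' b' P
      = sandwich a b (Y - P) + (sandwich a (b - b') P + sandwich (a - a') b' P) := by
  ext i j
  simp only [sandwich, Matrix.sub_apply, Matrix.add_apply, Pi.sub_apply, map_sub]
  ring

variable [Fintype Λ] [DecidableEq Λ]

/-- a sandwich is a two-sided product with diagonal matrices. [folklore] -/
theorem sandwich_eq_diagonal_mul (a b : Λ → ℂ) (X : Matrix (Λ × Fin d) (Λ × Fin d) ℂ) :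
    sandwich a b X
      = Matrix.diagonal (fun i : Λ × Fin d => a i.1) * X
          * Matrix.diagonal (fun j : Λ × Fin d => conj (b j.1)) := by
  ext i j
  simp only [sandwich, Matrix.mul_diagonal, Matrix.diagonal_mul]

/-- **operator norm of a sandwich:** `‖D_a X D_b^*‖ ≤ (sup|a|)·‖X‖·(sup|b|)`
(`Matrix.l2_opNorm_mul`, `B5G183RateL2Op.opNorm_diagonal_le`). [folklore] -/
theorem opNorm_sandwich_le {a b : Λ → ℂ} {A B : ℝ} (hA : 0 ≤ A) (hB : 0 ≤ B)
    (ha : ∀ i, ‖a i‖ ≤ A) (hb : ∀ i, ‖b i‖ ≤ B) (X : Matrix (Λ × Fin d) (Λ × Fin d) ℂ) :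
    ‖sandwich a b X‖ ≤ A * ‖X‖ * B := by
  rw [sandwich_eq_diagonal_mul]
  have h1 : ‖Matrix.diagonal (fun i : Λ × Fin d => a i.1)‖ ≤ A :=
    opNorm_diagonal_le _ hA (fun i => ha i.1)
  have h2 : ‖Matrix.diagonal (fun j : Λ × Fin d => conj (b j.1))‖ ≤ B :=
    opNorm_diagonal_le _ hB (fun j => by rw [Complex.norm_conj]; exact hb j.1)
  calc _ ≤ ‖Matrix.diagonal (fun i : Λ × Fin d => a i.1) * X‖
            * ‖Matrix.diagonal (fun j : Λ × Fin d => conj (b j.1))‖ := Matrix.l2_opNorm_mul _ _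
    _ ≤ (‖Matrix.diagonal (fun i : Λ × Fin d => a i.1)‖ * ‖X‖)
            * ‖Matrix.diagonal (fun j : Λ × Fin d => conj (b j.1))‖ := by
          gcongr; exact Matrix.l2_opNorm_mul _ _
    _ ≤ (A * ‖X‖) * B := by gcongr

/-- **the abstract eta-rate of a re-weighted sandwich:** if `‖Y − P‖ ≤ δ` (the rate of the inner
object), the outer weights obey `|a| ≤ A`, `|b| ≤ B`, and the planted outer weights `a′`, `b′` differ from
them by `|a − a′| ≤ α`, `|b − b′| ≤ β` in sup norm, then
`‖D_a Y D_b^* − D_{a′} P D_{b′}^*‖ ≤ A·δ·B + (A·‖P‖·β + α·‖P‖·B′)` with `|b′| ≤ B′`. [folklore] -/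
theorem opNorm_sandwich_sub_sandwich_le {a a' b b' : Λ → ℂ} {A B B' α β δ : ℝ}
    (hA : 0 ≤ A) (hB : 0 ≤ B) (hB' : 0 ≤ B') (hα : 0 ≤ α) (hβ : 0 ≤ β)
    (ha : ∀ i, ‖a i‖ ≤ A) (hb : ∀ i, ‖b i‖ ≤ B) (hb' : ∀ i, ‖b' i‖ ≤ B')
    (haa : ∀ i, ‖a i - a' i‖ ≤ α) (hbb : ∀ i, ‖b i - b' i‖ ≤ β)
    (Y P : Matrix (Λ × Fin d) (Λ × Fin d) ℂ) (hYP : ‖Y - P‖ ≤ δ) :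
    ‖sandwich a b Y - sandwich a' b' P‖ ≤ A * δ * B + (A * ‖P‖ * β + α * ‖P‖ * B') := by
  rw [sandwich_sub_sandwich]
  have hδ : 0 ≤ δ := le_trans (norm_nonneg _) hYP
  refine le_trans (norm_add_le _ _) (add_le_add ?_ (le_trans (norm_add_le _ _) (add_le_add ?_ ?_)))
  · calc _ ≤ A * ‖Y - P‖ * B := opNorm_sandwich_le hA hB ha hb _
      _ ≤ A * δ * B := by gcongr
  · exact opNorm_sandwich_le hA hβ ha (fun i => by simpa [Pi.sub_apply] using hbb i) _
  · exact opNorm_sandwich_le hα hB' (fun i => by simpa [Pi.sub_apply] using haa i) hb' _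

end Algebra

/-! ## §2 Planting a sandwich [folklore] -/

section Plant

variable {N R : ℕ} [NeZero N] [NeZero R]

omit [NeZero N] in
/-- `unpair K = some k` forces `K = ι k`. [folklore] -/
theorem iota_of_unpair {s : Fin d → ℝ} {K : Fin d → Fin (R * N)} {k : Fin d → Fin N}
    (h : unpair R s K = some k) : iota R k s = K := by
  unfold unpair at h
  by_cases hex : ∃ k₁ : Fin d → Fin N, iota R k₁ s = K
  · rw [dif_pos hex] at h
    cases h
    exact hex.choose_spec
  · rw [dif_neg hex] at h
    cases h

omit [NeZero N] in
/-- **planting commutes with sandwiching:** `plant (D_{w₁} M D_{w₂}^*) = D_{e₁} (plant M) D_{e₂}^*` for ANY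
level-`RN` weights `e₁`, `e₂` extending `w₁`, `w₂` along `ι` (their values on the unpaired classes are
irrelevant: `plant M` vanishes there). [cite: King1986, (4.19) p.672] [folklore] -/
theorem plant_sandwich {s : Fin d → ℝ} (w₁ w₂ : (Fin d → Fin N) → ℂ)
    (e₁ e₂ : (Fin d → Fin (R * N)) → ℂ) (h₁ : ∀ k, e₁ (iota R k s) = w₁ k)
    (h₂ : ∀ k, e₂ (iota R k s) = w₂ k)
    (M : Matrix ((Fin d → Fin N) × Fin d) ((Fin d → Fin N) × Fin d) ℂ) :
    plant R s (sandwich w₁ w₂ M) = sandwich e₁ e₂ (plant R s M) := by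
  ext i j
  unfold plant sandwich
  cases hi : unpair R s i.1 with
  | none => simp [hi]
  | some k =>
    cases hj : unpair R s j.1 with
    | none => simp [hi, hj]
    | some k' =>
      simp only [hi, hj]
      rw [← iota_of_unpair hi, ← iota_of_unpair hj, h₁ k, h₂ k']

/-- the canonical extension of a level-`N` weight along `ι`, by a prescribed level-`RN` weight on the
unpaired classes. [folklore] -/
def extend (R : ℕ) [NeZero R] (s : Fin d → ℝ) (w : (Fin d → Fin N) → ℂ)
    (e : (Fin d → Fin (R * N)) → ℂ) (K : Fin d → Fin (R * N)) : ℂ :=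
  match unpair R s K with
  | some k => w k
  | none => e K

omit [NeZero N] in
/-- `extend w e (ι k) = w k`. [folklore] -/
theorem extend_iota (hN : 1 ≤ N) {s : Fin d → ℝ} (hs : ∀ ν, |s ν| ≤ Real.pi)
    (w : (Fin d → Fin N) → ℂ) (e : (Fin d → Fin (R * N)) → ℂ) (k : Fin d → Fin N) :
    extend R s w e (iota R k s) = w k := by
  unfold extend
  simp only [unpair_iota hN hs]

omit [NeZero N] in
/-- `extend w e K = e K` on an unpaired class. [folklore] -/
theorem extend_unpaired {s : Fin d → ℝ} (w : (Fin d → Fin N) → ℂ) (e : (Fin d → Fin (R * N)) → ℂ)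
    {K : Fin d → Fin (R * N)} (hu : ∀ k : Fin d → Fin N, iota R k s ≠ K) :
    extend R s w e K = e K := by
  unfold extend
  simp only [unpair_of_unpaired hu]

omit [NeZero N] in
/-- a sup bound for an extension from sup bounds on the paired values and on `e`. [folklore] -/
theorem norm_extend_le {s : Fin d → ℝ} {w : (Fin d → Fin N) → ℂ} {e : (Fin d → Fin (R * N)) → ℂ}
    {B : ℝ} (hw : ∀ k, ‖w k‖ ≤ B) (he : ∀ K, ‖e K‖ ≤ B) (K : Fin d → Fin (R * N)) :
    ‖extend R s w e K‖ ≤ B := by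
  unfold extend
  cases unpair R s K with
  | none => exact he K
  | some k => exact hw k

omit [NeZero N] in
/-- the sup distance between a level-`RN` weight and the extension of a level-`N` weight BY ITSELF is the
sup over the PAIRED classes of `|e(ιk) − w(k)|`. [folklore] -/
theorem norm_sub_extend_le (hN : 1 ≤ N) {s : Fin d → ℝ} (hs : ∀ ν, |s ν| ≤ Real.pi)
    {w : (Fin d → Fin N) → ℂ} {e : (Fin d → Fin (R * N)) → ℂ} {β : ℝ} (hβ : 0 ≤ β)
    (h : ∀ k, ‖e (iota R k s) - w k‖ ≤ β) (K : Fin d → Fin (R * N)) :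
    ‖e K - extend R s w e K‖ ≤ β := by
  by_cases hp : ∃ k : Fin d → Fin N, iota R k s = K
  · obtain ⟨k, rfl⟩ := hp
    rw [extend_iota hN hs]
    exact h k
  · push Not at hp
    rw [extend_unpaired w e hp, sub_self, norm_zero]
    exact hβ

end Plant

/-! ## §3 The King-weighted derivative symbol `W²·∂_ν` [folklore] -/

section Weights

variable {N R : ℕ} [NeZero N] [NeZero R]

/-- the weighted derivative symbol `(W_k)²·∂^{(n)}_ν(q̃_k)` — TWO King alias weights (4.20) times the
lattice-derivative symbol of the class. [cite: King1986, (4.19)–(4.20) p.672] [folklore] -/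
def wdSym (n : ℕ) (k : Fin d → Fin n) (s : Fin d → ℝ) (ν : Fin d) : ℂ :=
  ((Wc n k s ^ 2 : ℝ) : ℂ) * dSym n k s ν

omit [NeZero N] in
/-- `|W²·∂_ν(q̃)| ≤ W²·‖q̃‖_∞ ≤ π`, uniformly in the class and the level. [cite: King1986, (4.20) p.672]
[folklore] -/
theorem norm_wdSym_le {n : ℕ} (hn : 1 ≤ n) (k : Fin d → Fin n) {s : Fin d → ℝ}
    (hs : ∀ ν, |s ν| ≤ Real.pi) (ν : Fin d) : ‖wdSym n k s ν‖ ≤ Real.pi := by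
  unfold wdSym
  rw [norm_mul, Complex.norm_real, Real.norm_eq_abs, abs_of_nonneg (sq_nonneg _)]
  calc _ ≤ Wc n k s ^ 2 * ‖symmAlias n k s‖ := by
          gcongr; exact B5G183RateL2.norm_dSym_le hn k s ν
    _ ≤ Real.pi := (Wc_sq_mul_norm_le k hs).1

omit [NeZero N] in
/-- **the eta-RATE of the weighted symbol on the paired classes:**
`|W²(ιk)·∂^{(RN)}_ν(q̃_{ιk}) − W²(k)·∂^{(N)}_ν(q̃_k)| = W(k)²·|∂^{(RN)}_ν − ∂^{(N)}_ν|(q̃_k) ≤ W²·6‖q̃‖²/N ≤ 6π²/N`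
(`Wc_iota`, `B5G183RateL2.dSym_rate_le`, `Wc_sq_mul_norm_le`). [cite: King1986, (4.20), (4.23) p.672]
[folklore] -/
theorem wdSym_rate_le (hN : 1 ≤ N) (hR : 1 ≤ R) (k : Fin d → Fin N) {s : Fin d → ℝ}
    (hs : ∀ ν, |s ν| ≤ Real.pi) (ν : Fin d) :
    ‖wdSym (R * N) (iota R k s) s ν - wdSym N k s ν‖ ≤ 6 * Real.pi ^ 2 / N := by
  have hN0 : (0 : ℝ) < N := by exact_mod_cast hN
  unfold wdSym
  rw [Wc_iota hN k hs, ← mul_sub, norm_mul, Complex.norm_real, Real.norm_eq_abs,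
    abs_of_nonneg (sq_nonneg _)]
  calc _ ≤ Wc N k s ^ 2 * (6 * ‖symmAlias N k s‖ ^ 2 / N) := by
          gcongr; exact dSym_rate_le hN hR k hs ν
    _ = 6 * (Wc N k s ^ 2 * ‖symmAlias N k s‖ ^ 2) / N := by ring
    _ ≤ 6 * Real.pi ^ 2 / N := by gcongr; exact (Wc_sq_mul_norm_le k hs).2

end Weights

/-! ## §4 The ORDER-TWO OPERATOR eta-rate in the currency `∂_ν ⊗ W²∂_{ν′}` (and `W²∂_ν ⊗ ∂_{ν′}`) [folklore] -/

section Fibre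

variable {N R : ℕ} [NeZero N] [NeZero R]

omit [NeZero N] [NeZero R] in
/-- `0 ≤ Casm`. [folklore] -/
theorem Casm_nonneg (d : ℕ) (a : ℝ) : 0 ≤ Casm d a := by
  have h1 := Cdg_nonneg
  have h2 := (Chs_nonneg d a).2.2.2
  unfold Casm
  positivity

/-- the constant of the weighted order-two operator eta-rate. [folklore] -/
def C2op (d : ℕ) (a : ℝ) : ℝ :=
  Real.pi * Casm d a + 6 * Real.pi ^ 2 * (gamma0 d a + Casm d a)

omit [NeZero N] [NeZero R] in
/-- the final arithmetic: `π·(Casm/N) + (g + Casm/N)·(6π²/N) ≤ C2op/N` for `N ≥ 1`, `g ≤ gamma0`-type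
bookkeeping. [folklore] -/
theorem arith_C2op (hN : 1 ≤ N) (a : ℝ) {g : ℝ} (hg : g ≤ gamma0 d a) :
    Real.pi * (Casm d a / N) + (g + Casm d a / N) * (6 * Real.pi ^ 2 / N) ≤ C2op d a / N := by
  have hN0 : (0 : ℝ) < N := by exact_mod_cast hN
  have hN1 : (1 : ℝ) ≤ N := by exact_mod_cast hN
  have hC := Casm_nonneg d a
  have hCN : Casm d a / N ≤ Casm d a := div_le_self hC hN1
  have hπ := Real.pi_pos
  calc Real.pi * (Casm d a / N) + (g + Casm d a / N) * (6 * Real.pi ^ 2 / N)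
      = (Real.pi * Casm d a + 6 * Real.pi ^ 2 * (g + Casm d a / N)) / N := by ring
    _ ≤ (Real.pi * Casm d a + 6 * Real.pi ^ 2 * (gamma0 d a + Casm d a)) / N := by
        gcongr
    _ = C2op d a / N := by unfold C2op; ring

/-- **THE ORDER-TWO OPERATOR eta-RATE OF `∇_ν G ∇_{ν′}^*` (1.89) AT `U = 1` IN THE CURRENCY
`∂_ν ⊗ W²∂_{ν′}`:** for `N, R ≥ 1`, `a > 0`, a nonzero reduced momentum `p′ = s` of the zone and directions
`ν, ν′`,
`‖D_{∂^{(RN)}_ν} G^{(RN)}(p′) D_{W²∂^{(RN)}_{ν′}}^* − plant_R(D_{∂^{(N)}_ν} G^{(N)}(p′) D_{W²∂^{(N)}_{ν′}}^*)‖_(ℓ²→ℓ²)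
≤ C2op(d,a)/N`, where `W = Wc` is King's (4.20) alias weight of the class. PROOF = soft operator algebra
from the ORDER-ONE operator rate `B5G183RateL2Asm.orderOneOpRateResidualL_holds` (`Casm/N`), the uniform
order-one bound `B5Prop11Fiber.opNorm_D_G_le` (`gamma0`), `plant_sandwich`, and the two facts about the
outer weight: `|W²∂| ≤ π` (`norm_wdSym_le`) and its own eta-rate `6π²/N` on the paired classes
(`wdSym_rate_le`); on the unpaired classes the planted operator vanishes, so the outer weight is extended
by itself there (`extend`, `norm_sub_extend_le`). CONTRAST: with NO alias weight the same statement is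
FALSE for every constant (`B5G183RateObstructionOp.not_orderTwoOpRateResidual`). Print states NO rate;
the currency, the pairing and every constant are OURS. [cite: Balaban1984PropagatorsI, (1.83) p.31,
Prop. 1.1 (1.89) p.33; King1986, (4.19)–(4.20), (4.23) p.672, (4.24) p.673] [folklore] -/
theorem opNorm_D_G_DW_rate (hN : 1 ≤ N) (hR : 1 ≤ R) (hRN : 1 ≤ R * N) (a : ℝ) (ha : 0 < a)
    {s : Fin d → ℝ} (hs : ∀ ν, |s ν| ≤ Real.pi) (hs0 : s ≠ 0) (ν ν' : Fin d) :
    ‖sandwich (fun K => dSym (R * N) K s ν) (fun K => wdSym (R * N) K s ν')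
          (balabanFiber (R * N) hRN a ha s hs hs0).G
        - plant R s (sandwich (fun k => dSym N k s ν) (fun k => wdSym N k s ν')
          (balabanFiber N hN a ha s hs hs0).G)‖
      ≤ C2op d a / N := by
  classical
  set Y := sandwich (fun K => dSym (R * N) K s ν) (fun _ => (1 : ℂ))
    (balabanFiber (R * N) hRN a ha s hs hs0).G with hY
  set P := plant R s (sandwich (fun k => dSym N k s ν) (fun _ => (1 : ℂ))
    (balabanFiber N hN a ha s hs hs0).G) with hP
  have hrate : ‖Y - P‖ ≤ Casm d a / N :=
    orderOneOpRateResidualL_holds d a N R hN hRN ha s hs hs0 ν hR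
  have hYb : ‖Y‖ ≤ gamma0 d a := opNorm_D_G_le (R * N) hRN a ha s hs hs0 ν
  have hPb : ‖P‖ ≤ gamma0 d a + Casm d a / N := by
    calc ‖P‖ = ‖Y - (Y - P)‖ := by rw [sub_sub_cancel]
      _ ≤ ‖Y‖ + ‖Y - P‖ := norm_sub_le _ _
      _ ≤ gamma0 d a + Casm d a / N := add_le_add hYb hrate
  have e1 : sandwich (fun K => dSym (R * N) K s ν) (fun K => wdSym (R * N) K s ν')
        (balabanFiber (R * N) hRN a ha s hs hs0).G
      = sandwich (fun _ => (1 : ℂ)) (fun K => wdSym (R * N) K s ν') Y := sandwich_peel_right _ _ _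
  have e2 : plant R s (sandwich (fun k => dSym N k s ν) (fun k => wdSym N k s ν')
        (balabanFiber N hN a ha s hs hs0).G)
      = sandwich (fun _ => (1 : ℂ))
          (extend R s (fun k => wdSym N k s ν') (fun K => wdSym (R * N) K s ν')) P := by
    rw [sandwich_peel_right, hP]
    exact plant_sandwich (N := N) (R := R) (fun _ => (1 : ℂ)) (fun k => wdSym N k s ν') (fun _ => (1 : ℂ))
      (extend R s (fun k => wdSym N k s ν') (fun K => wdSym (R * N) K s ν')) (fun k => rfl)
      (fun k => extend_iota (N := N) (R := R) hN hs _ _ k) _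
  rw [e1, e2]
  have hπ := Real.pi_pos
  have hN0 : (0 : ℝ) < N := by exact_mod_cast hN
  have key := opNorm_sandwich_sub_sandwich_le
    (a := fun _ : (Fin d → Fin (R * N)) => (1 : ℂ)) (a' := fun _ => (1 : ℂ))
    (b := fun K => wdSym (R * N) K s ν')
    (b' := extend R s (fun k => wdSym N k s ν') (fun K => wdSym (R * N) K s ν'))
    (A := 1) (B := Real.pi) (B' := Real.pi) (α := 0) (β := 6 * Real.pi ^ 2 / N) (δ := Casm d a / N)
    zero_le_one hπ.le hπ.le le_rfl (by positivity)
    (fun _ => by simp) (fun K => norm_wdSym_le hRN K hs ν')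
    (fun K => norm_extend_le (w := fun k => wdSym N k s ν') (e := fun K => wdSym (R * N) K s ν')
      (B := Real.pi) (fun k => norm_wdSym_le hN k hs ν') (fun K => norm_wdSym_le hRN K hs ν') K)
    (fun _ => by simp)
    (fun K => norm_sub_extend_le (w := fun k => wdSym N k s ν') (e := fun K => wdSym (R * N) K s ν')
      (β := 6 * Real.pi ^ 2 / N) hN hs (by positivity) (fun k => wdSym_rate_le hN hR k hs ν') K)
    Y P hrate
  calc _ ≤ 1 * (Casm d a / N) * Real.pi + (1 * ‖P‖ * (6 * Real.pi ^ 2 / N) + 0 * ‖P‖ * Real.pi) := key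
    _ = Real.pi * (Casm d a / N) + ‖P‖ * (6 * Real.pi ^ 2 / N) := by ring
    _ ≤ Real.pi * (Casm d a / N) + (gamma0 d a + Casm d a / N) * (6 * Real.pi ^ 2 / N) := by
        gcongr
    _ ≤ C2op d a / N := arith_C2op hN a le_rfl

/-- **THE MIRRORED CURRENCY `W²∂_ν ⊗ ∂_{ν′}`** (the two King weights on the LEFT derivative): same rate,
from the right-weight order-one rate `B5G183RateL2Asm.orderOneOpRateResidualR_holds` and
`B5Prop11Fiber.opNorm_G_D_le`. [cite: Balaban1984PropagatorsI, Prop. 1.1 (1.89) p.33; King1986,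
(4.19)–(4.20), (4.23) p.672] [folklore] -/
theorem opNorm_DW_G_D_rate (hN : 1 ≤ N) (hR : 1 ≤ R) (hRN : 1 ≤ R * N) (a : ℝ) (ha : 0 < a)
    {s : Fin d → ℝ} (hs : ∀ ν, |s ν| ≤ Real.pi) (hs0 : s ≠ 0) (ν ν' : Fin d) :
    ‖sandwich (fun K => wdSym (R * N) K s ν) (fun K => dSym (R * N) K s ν')
          (balabanFiber (R * N) hRN a ha s hs hs0).G
        - plant R s (sandwich (fun k => wdSym N k s ν) (fun k => dSym N k s ν')
          (balabanFiber N hN a ha s hs hs0).G)‖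
      ≤ C2op d a / N := by
  classical
  set Y := sandwich (fun _ => (1 : ℂ)) (fun K => dSym (R * N) K s ν')
    (balabanFiber (R * N) hRN a ha s hs hs0).G with hY
  set P := plant R s (sandwich (fun _ => (1 : ℂ)) (fun k => dSym N k s ν')
    (balabanFiber N hN a ha s hs hs0).G) with hP
  have hrate : ‖Y - P‖ ≤ Casm d a / N :=
    orderOneOpRateResidualR_holds d a N R hN hRN ha s hs hs0 ν' hR
  have hYb : ‖Y‖ ≤ gamma0 d a := opNorm_G_D_le (R * N) hRN a ha s hs hs0 ν'
  have hPb : ‖P‖ ≤ gamma0 d a + Casm d a / N := by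
    calc ‖P‖ = ‖Y - (Y - P)‖ := by rw [sub_sub_cancel]
      _ ≤ ‖Y‖ + ‖Y - P‖ := norm_sub_le _ _
      _ ≤ gamma0 d a + Casm d a / N := add_le_add hYb hrate
  have e1 : sandwich (fun K => wdSym (R * N) K s ν) (fun K => dSym (R * N) K s ν')
        (balabanFiber (R * N) hRN a ha s hs hs0).G
      = sandwich (fun K => wdSym (R * N) K s ν) (fun _ => (1 : ℂ)) Y := sandwich_peel_left _ _ _
  have e2 : plant R s (sandwich (fun k => wdSym N k s ν) (fun k => dSym N k s ν')
        (balabanFiber N hN a ha s hs hs0).G)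
      = sandwich (extend R s (fun k => wdSym N k s ν) (fun K => wdSym (R * N) K s ν))
          (fun _ => (1 : ℂ)) P := by
    rw [sandwich_peel_left, hP]
    exact plant_sandwich (N := N) (R := R) (fun k => wdSym N k s ν) (fun _ => (1 : ℂ))
      (extend R s (fun k => wdSym N k s ν) (fun K => wdSym (R * N) K s ν)) (fun _ => (1 : ℂ))
      (fun k => extend_iota (N := N) (R := R) hN hs _ _ k) (fun k => rfl) _
  rw [e1, e2]
  have hπ := Real.pi_pos
  have hN0 : (0 : ℝ) < N := by exact_mod_cast hN
  have key := opNorm_sandwich_sub_sandwich_le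
    (a := fun K => wdSym (R * N) K s ν)
    (a' := extend R s (fun k => wdSym N k s ν) (fun K => wdSym (R * N) K s ν))
    (b := fun _ : (Fin d → Fin (R * N)) => (1 : ℂ)) (b' := fun _ => (1 : ℂ))
    (A := Real.pi) (B := 1) (B' := 1) (α := 6 * Real.pi ^ 2 / N) (β := 0) (δ := Casm d a / N)
    hπ.le zero_le_one zero_le_one (by positivity) le_rfl
    (fun K => norm_wdSym_le hRN K hs ν) (fun _ => by simp) (fun _ => by simp)
    (fun K => norm_sub_extend_le (w := fun k => wdSym N k s ν) (e := fun K => wdSym (R * N) K s ν)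
      (β := 6 * Real.pi ^ 2 / N) hN hs (by positivity) (fun k => wdSym_rate_le hN hR k hs ν) K)
    (fun _ => by simp)
    Y P hrate
  calc _ ≤ Real.pi * (Casm d a / N) * 1 + (Real.pi * ‖P‖ * 0 + 6 * Real.pi ^ 2 / N * ‖P‖ * 1) := key
    _ = Real.pi * (Casm d a / N) + ‖P‖ * (6 * Real.pi ^ 2 / N) := by ring
    _ ≤ Real.pi * (Casm d a / N) + (gamma0 d a + Casm d a / N) * (6 * Real.pi ^ 2 / N) := by
        gcongr
    _ ≤ C2op d a / N := arith_C2op hN a le_rfl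

/-- **uniform companion:** the King-weighted order-two sandwich is bounded by print's constant,
`‖D_{∂_ν} G(p′) D_{W²∂_{ν′}}^*‖ ≤ gamma0 d a` (`|W²| ≤ 1` and b05's `opNorm_D_G_D_le`), so the weighted object
carries BOTH the uniform bound of (1.89) and the eta-rate. [cite: Balaban1984PropagatorsI, Prop. 1.1 (1.89)
p.33] [folklore] -/
theorem opNorm_D_G_DW_le {n : ℕ} [NeZero n] (hn : 1 ≤ n) (a : ℝ) (ha : 0 < a) {s : Fin d → ℝ}
    (hs : ∀ ν, |s ν| ≤ Real.pi) (hs0 : s ≠ 0) (ν ν' : Fin d) :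
    ‖sandwich (fun K => dSym n K s ν) (fun K => wdSym n K s ν') (balabanFiber n hn a ha s hs hs0).G‖
      ≤ gamma0 d a := by
  classical
  have e : sandwich (fun K => dSym n K s ν) (fun K => wdSym n K s ν') (balabanFiber n hn a ha s hs hs0).G
      = sandwich (fun _ => (1 : ℂ)) (fun K => ((Wc n K s ^ 2 : ℝ) : ℂ))
          (sandwich (fun K => dSym n K s ν) (fun K => dSym n K s ν') (balabanFiber n hn a ha s hs hs0).G) := by
    ext i j
    simp only [sandwich, wdSym, map_mul, Complex.conj_ofReal, one_mul]
    ring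
  rw [e]
  have h1 : ∀ K : Fin d → Fin n, ‖(((Wc n K s ^ 2 : ℝ) : ℂ))‖ ≤ 1 := fun K => by
    rw [Complex.norm_real, Real.norm_eq_abs, abs_of_nonneg (sq_nonneg _)]
    have h := Wc_nonneg_le_one (n := n) K hs
    nlinarith [h.1, h.2]
  calc _ ≤ 1 * ‖sandwich (fun K => dSym n K s ν) (fun K => dSym n K s ν')
              (balabanFiber n hn a ha s hs hs0).G‖ * 1 :=
          opNorm_sandwich_le zero_le_one zero_le_one (fun _ => by simp) h1 _
    _ ≤ 1 * gamma0 d a * 1 := by gcongr; exact opNorm_D_G_D_le n hn a ha s hs hs0 ν ν'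
    _ = gamma0 d a := by ring

/-- **TYPED STATEMENT (the King-weighted order-two residual, right currency) — PROVED below:** verbatim the
binder shape of the REFUTED `B5G183RateObstructionOp.OrderTwoOpRateResidual`, with the right derivative
weight `dSym ν′` replaced by `W²·dSym ν′`. [cite: Balaban1984PropagatorsI, Prop. 1.1 (1.89) p.33; King1986,
(4.19)–(4.20) p.672] [folklore] -/
def OrderTwoOpRateResidualW (d : ℕ) (a C : ℝ) : Prop :=
  ∀ (N R : ℕ) [NeZero N] [NeZero R] (hN : 1 ≤ N) (hRN : 1 ≤ R * N) (ha : 0 < a) (s : Fin d → ℝ)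
    (hs : ∀ ν, |s ν| ≤ Real.pi) (hs0 : s ≠ 0) (ν ν' : Fin d), 1 ≤ R →
    ‖sandwich (fun K => dSym (R * N) K s ν) (fun K => wdSym (R * N) K s ν')
          (balabanFiber (R * N) hRN a ha s hs hs0).G
        - plant R s (sandwich (fun k => dSym N k s ν) (fun k => wdSym N k s ν')
          (balabanFiber N hN a ha s hs hs0).G)‖
      ≤ C / N

omit [NeZero N] [NeZero R] in
/-- **the King-weighted order-two residual HOLDS with `C = C2op d a`** — whereas the unweighted one is false
for every `C` (`B5G183RateObstructionOp.no_orderTwoOpRate`). [cite: Balaban1984PropagatorsI, Prop. 1.1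
(1.89) p.33; King1986, (4.19)–(4.20), (4.23) p.672] [folklore] -/
theorem orderTwoOpRateResidualW_holds (d : ℕ) (a : ℝ) : OrderTwoOpRateResidualW d a (C2op d a) := by
  intro N R _ _ hN hRN ha s hs hs0 ν ν' hR
  exact opNorm_D_G_DW_rate hN hR hRN a ha hs hs0 ν ν'

/-- **ORDER TWO DECIDED IN BOTH DIRECTIONS (fibrewise, `ℓ²`-operator norm, `U = 1`):** zero King weights —
NO rate for any constant (in `d ≥ 2`); two King weights on one side — the full rate `C2op/N`.
[cite: Balaban1984PropagatorsI, Prop. 1.1 (1.89) p.33; King1986, (4.19)–(4.20) p.672] [folklore] -/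
theorem orderTwo_dichotomy {μ₁ μ₂ : Fin d} (hne : μ₁ ≠ μ₂) (a : ℝ) (ha : 0 < a) :
    (¬ ∃ C, B5G183RateObstructionOp.OrderTwoOpRateResidual d a C)
      ∧ OrderTwoOpRateResidualW d a (C2op d a) :=
  ⟨B5G183RateObstructionOp.no_orderTwoOpRate hne a ha, orderTwoOpRateResidualW_holds d a⟩

end Fibre

/-! ## §5 The one-sided order-two items `∇_ν∇_{ν′}G`, `G∇*_ν∇*_{ν′}` of (1.89) in the currency `∂_ν·W²∂_{ν′}` [folklore] -/

section OneSided

variable {Λ : Type*}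

/-- peeling a product weight on the left: `D_{ℓ·a} X D_r^* = D_a (D_ℓ X D_r^*) D_1^*`. [folklore] -/
theorem sandwich_mul_left (ℓ a r : Λ → ℂ) (X : Matrix (Λ × Fin d) (Λ × Fin d) ℂ) :
    sandwich (fun K => ℓ K * a K) r X = sandwich a (fun _ => (1 : ℂ)) (sandwich ℓ r X) := by
  ext i j
  simp only [sandwich, map_one, mul_one]
  ring

/-- peeling a product weight on the right: `D_ℓ X D_{r·a}^* = D_1 (D_ℓ X D_r^*) D_a^*`. [folklore] -/
theorem sandwich_mul_right (ℓ r a : Λ → ℂ) (X : Matrix (Λ × Fin d) (Λ × Fin d) ℂ) :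
    sandwich ℓ (fun K => r K * a K) X = sandwich (fun _ => (1 : ℂ)) a (sandwich ℓ r X) := by
  ext i j
  simp only [sandwich, map_mul, one_mul]
  ring

variable {N R : ℕ} [NeZero N] [NeZero R]

/-- **`∇_ν ∇_{ν′} G` of (1.89), King-weighted:** `‖D_{∂^{(RN)}_ν·W²∂^{(RN)}_{ν′}} F_{RN} − plant_R(D_{∂^{(N)}_ν·W²∂^{(N)}_{ν′}}
F_N)‖ ≤ C2op(d,a)/N` — the same soft algebra (`sandwich_mul_left`, `plant_sandwich`, the order-one rate
`orderOneOpRateResidualL_holds`, `opNorm_D_G_le`). [cite: Balaban1984PropagatorsI, Prop. 1.1 (1.89) p.33;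
King1986, (4.19)–(4.20), (4.23) p.672] [folklore] -/
theorem opNorm_DDW_G_rate (hN : 1 ≤ N) (hR : 1 ≤ R) (hRN : 1 ≤ R * N) (a : ℝ) (ha : 0 < a)
    {s : Fin d → ℝ} (hs : ∀ ν, |s ν| ≤ Real.pi) (hs0 : s ≠ 0) (ν ν' : Fin d) :
    ‖sandwich (fun K => dSym (R * N) K s ν * wdSym (R * N) K s ν') (fun _ => (1 : ℂ))
          (balabanFiber (R * N) hRN a ha s hs hs0).G
        - plant R s (sandwich (fun k => dSym N k s ν * wdSym N k s ν') (fun _ => (1 : ℂ))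
          (balabanFiber N hN a ha s hs hs0).G)‖
      ≤ C2op d a / N := by
  classical
  set Y := sandwich (fun K => dSym (R * N) K s ν) (fun _ => (1 : ℂ))
    (balabanFiber (R * N) hRN a ha s hs hs0).G with hY
  set P := plant R s (sandwich (fun k => dSym N k s ν) (fun _ => (1 : ℂ))
    (balabanFiber N hN a ha s hs hs0).G) with hP
  have hrate : ‖Y - P‖ ≤ Casm d a / N :=
    orderOneOpRateResidualL_holds d a N R hN hRN ha s hs hs0 ν hR
  have hYb : ‖Y‖ ≤ gamma0 d a := opNorm_D_G_le (R * N) hRN a ha s hs hs0 ν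
  have hPb : ‖P‖ ≤ gamma0 d a + Casm d a / N := by
    calc ‖P‖ = ‖Y - (Y - P)‖ := by rw [sub_sub_cancel]
      _ ≤ ‖Y‖ + ‖Y - P‖ := norm_sub_le _ _
      _ ≤ gamma0 d a + Casm d a / N := add_le_add hYb hrate
  have e1 : sandwich (fun K => dSym (R * N) K s ν * wdSym (R * N) K s ν') (fun _ => (1 : ℂ))
        (balabanFiber (R * N) hRN a ha s hs hs0).G
      = sandwich (fun K => wdSym (R * N) K s ν') (fun _ => (1 : ℂ)) Y := sandwich_mul_left _ _ _ _
  have e2 : plant R s (sandwich (fun k => dSym N k s ν * wdSym N k s ν') (fun _ => (1 : ℂ))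
        (balabanFiber N hN a ha s hs hs0).G)
      = sandwich (extend R s (fun k => wdSym N k s ν') (fun K => wdSym (R * N) K s ν'))
          (fun _ => (1 : ℂ)) P := by
    rw [sandwich_mul_left, hP]
    exact plant_sandwich (N := N) (R := R) (fun k => wdSym N k s ν') (fun _ => (1 : ℂ))
      (extend R s (fun k => wdSym N k s ν') (fun K => wdSym (R * N) K s ν')) (fun _ => (1 : ℂ))
      (fun k => extend_iota (N := N) (R := R) hN hs _ _ k) (fun k => rfl) _
  rw [e1, e2]
  have hπ := Real.pi_pos
  have hN0 : (0 : ℝ) < N := by exact_mod_cast hN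
  have key := opNorm_sandwich_sub_sandwich_le
    (a := fun K => wdSym (R * N) K s ν')
    (a' := extend R s (fun k => wdSym N k s ν') (fun K => wdSym (R * N) K s ν'))
    (b := fun _ : (Fin d → Fin (R * N)) => (1 : ℂ)) (b' := fun _ => (1 : ℂ))
    (A := Real.pi) (B := 1) (B' := 1) (α := 6 * Real.pi ^ 2 / N) (β := 0) (δ := Casm d a / N)
    hπ.le zero_le_one zero_le_one (by positivity) le_rfl
    (fun K => norm_wdSym_le hRN K hs ν') (fun _ => by simp) (fun _ => by simp)
    (fun K => norm_sub_extend_le (w := fun k => wdSym N k s ν') (e := fun K => wdSym (R * N) K s ν')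
      (β := 6 * Real.pi ^ 2 / N) hN hs (by positivity) (fun k => wdSym_rate_le hN hR k hs ν') K)
    (fun _ => by simp)
    Y P hrate
  calc _ ≤ Real.pi * (Casm d a / N) * 1 + (Real.pi * ‖P‖ * 0 + 6 * Real.pi ^ 2 / N * ‖P‖ * 1) := key
    _ = Real.pi * (Casm d a / N) + ‖P‖ * (6 * Real.pi ^ 2 / N) := by ring
    _ ≤ Real.pi * (Casm d a / N) + (gamma0 d a + Casm d a / N) * (6 * Real.pi ^ 2 / N) := by
        gcongr
    _ ≤ C2op d a / N := arith_C2op hN a le_rfl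

/-- **`G ∇*_ν ∇*_{ν′}` of (1.89), King-weighted:** `‖F_{RN} D_{∂^{(RN)}_ν·W²∂^{(RN)}_{ν′}}^* − plant_R(F_N
D_{∂^{(N)}_ν·W²∂^{(N)}_{ν′}}^*)‖ ≤ C2op(d,a)/N` (`sandwich_mul_right`, `orderOneOpRateResidualR_holds`, `opNorm_G_D_le`).
[cite: Balaban1984PropagatorsI, Prop. 1.1 (1.89) p.33; King1986, (4.19)–(4.20), (4.23) p.672] [folklore] -/
theorem opNorm_G_DDW_rate (hN : 1 ≤ N) (hR : 1 ≤ R) (hRN : 1 ≤ R * N) (a : ℝ) (ha : 0 < a)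
    {s : Fin d → ℝ} (hs : ∀ ν, |s ν| ≤ Real.pi) (hs0 : s ≠ 0) (ν ν' : Fin d) :
    ‖sandwich (fun _ => (1 : ℂ)) (fun K => dSym (R * N) K s ν * wdSym (R * N) K s ν')
          (balabanFiber (R * N) hRN a ha s hs hs0).G
        - plant R s (sandwich (fun _ => (1 : ℂ)) (fun k => dSym N k s ν * wdSym N k s ν')
          (balabanFiber N hN a ha s hs hs0).G)‖
      ≤ C2op d a / N := by
  classical
  set Y := sandwich (fun _ => (1 : ℂ)) (fun K => dSym (R * N) K s ν)
    (balabanFiber (R * N) hRN a ha s hs hs0).G with hY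
  set P := plant R s (sandwich (fun _ => (1 : ℂ)) (fun k => dSym N k s ν)
    (balabanFiber N hN a ha s hs hs0).G) with hP
  have hrate : ‖Y - P‖ ≤ Casm d a / N :=
    orderOneOpRateResidualR_holds d a N R hN hRN ha s hs hs0 ν hR
  have hYb : ‖Y‖ ≤ gamma0 d a := opNorm_G_D_le (R * N) hRN a ha s hs hs0 ν
  have hPb : ‖P‖ ≤ gamma0 d a + Casm d a / N := by
    calc ‖P‖ = ‖Y - (Y - P)‖ := by rw [sub_sub_cancel]
      _ ≤ ‖Y‖ + ‖Y - P‖ := norm_sub_le _ _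
      _ ≤ gamma0 d a + Casm d a / N := add_le_add hYb hrate
  have e1 : sandwich (fun _ => (1 : ℂ)) (fun K => dSym (R * N) K s ν * wdSym (R * N) K s ν')
        (balabanFiber (R * N) hRN a ha s hs hs0).G
      = sandwich (fun _ => (1 : ℂ)) (fun K => wdSym (R * N) K s ν') Y := sandwich_mul_right _ _ _ _
  have e2 : plant R s (sandwich (fun _ => (1 : ℂ)) (fun k => dSym N k s ν * wdSym N k s ν')
        (balabanFiber N hN a ha s hs hs0).G)
      = sandwich (fun _ => (1 : ℂ))
          (extend R s (fun k => wdSym N k s ν') (fun K => wdSym (R * N) K s ν')) P := by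
    rw [sandwich_mul_right, hP]
    exact plant_sandwich (N := N) (R := R) (fun _ => (1 : ℂ)) (fun k => wdSym N k s ν') (fun _ => (1 : ℂ))
      (extend R s (fun k => wdSym N k s ν') (fun K => wdSym (R * N) K s ν')) (fun k => rfl)
      (fun k => extend_iota (N := N) (R := R) hN hs _ _ k) _
  rw [e1, e2]
  have hπ := Real.pi_pos
  have hN0 : (0 : ℝ) < N := by exact_mod_cast hN
  have key := opNorm_sandwich_sub_sandwich_le
    (a := fun _ : (Fin d → Fin (R * N)) => (1 : ℂ)) (a' := fun _ => (1 : ℂ))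
    (b := fun K => wdSym (R * N) K s ν')
    (b' := extend R s (fun k => wdSym N k s ν') (fun K => wdSym (R * N) K s ν'))
    (A := 1) (B := Real.pi) (B' := Real.pi) (α := 0) (β := 6 * Real.pi ^ 2 / N) (δ := Casm d a / N)
    zero_le_one hπ.le hπ.le le_rfl (by positivity)
    (fun _ => by simp) (fun K => norm_wdSym_le hRN K hs ν')
    (fun K => norm_extend_le (w := fun k => wdSym N k s ν') (e := fun K => wdSym (R * N) K s ν')
      (B := Real.pi) (fun k => norm_wdSym_le hN k hs ν') (fun K => norm_wdSym_le hRN K hs ν') K)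
    (fun _ => by simp)
    (fun K => norm_sub_extend_le (w := fun k => wdSym N k s ν') (e := fun K => wdSym (R * N) K s ν')
      (β := 6 * Real.pi ^ 2 / N) hN hs (by positivity) (fun k => wdSym_rate_le hN hR k hs ν') K)
    Y P hrate
  calc _ ≤ 1 * (Casm d a / N) * Real.pi + (1 * ‖P‖ * (6 * Real.pi ^ 2 / N) + 0 * ‖P‖ * Real.pi) := key
    _ = Real.pi * (Casm d a / N) + ‖P‖ * (6 * Real.pi ^ 2 / N) := by ring
    _ ≤ Real.pi * (Casm d a / N) + (gamma0 d a + Casm d a / N) * (6 * Real.pi ^ 2 / N) := by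
        gcongr
    _ ≤ C2op d a / N := arith_C2op hN a le_rfl

/-- **ALL SIX ITEMS OF (1.89) CARRY AN eta-RATE AT `U = 1` (fibrewise, `ℓ²`-operator norm), the order-two
ones in the King-weighted currency:** `G` (`B5G183RateOp.opNorm_G_rate'`-type, here not restated), `∇G` and
`G∇*` (`Casm/N`, order one, unweighted), `∇G∇*`, `∇∇G`, `G∇*∇*` (`C2op/N`, with `W²` on one derivative) —
packaged for the carver as one conjunction over a fibre. [cite: Balaban1984PropagatorsI, Prop. 1.1 (1.89)
p.33] [folklore] -/
theorem derivative_items_rate (hN : 1 ≤ N) (hR : 1 ≤ R) (hRN : 1 ≤ R * N) (a : ℝ) (ha : 0 < a)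
    {s : Fin d → ℝ} (hs : ∀ ν, |s ν| ≤ Real.pi) (hs0 : s ≠ 0) (ν ν' : Fin d) :
    ‖sandwich (fun K => dSym (R * N) K s ν) (fun _ => (1 : ℂ)) (balabanFiber (R * N) hRN a ha s hs hs0).G
        - plant R s (sandwich (fun k => dSym N k s ν) (fun _ => (1 : ℂ))
          (balabanFiber N hN a ha s hs hs0).G)‖ ≤ Casm d a / N
    ∧ ‖sandwich (fun _ => (1 : ℂ)) (fun K => dSym (R * N) K s ν) (balabanFiber (R * N) hRN a ha s hs hs0).G
        - plant R s (sandwich (fun _ => (1 : ℂ)) (fun k => dSym N k s ν)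
          (balabanFiber N hN a ha s hs hs0).G)‖ ≤ Casm d a / N
    ∧ ‖sandwich (fun K => dSym (R * N) K s ν) (fun K => wdSym (R * N) K s ν')
          (balabanFiber (R * N) hRN a ha s hs hs0).G
        - plant R s (sandwich (fun k => dSym N k s ν) (fun k => wdSym N k s ν')
          (balabanFiber N hN a ha s hs hs0).G)‖ ≤ C2op d a / N
    ∧ ‖sandwich (fun K => dSym (R * N) K s ν * wdSym (R * N) K s ν') (fun _ => (1 : ℂ))
          (balabanFiber (R * N) hRN a ha s hs hs0).G
        - plant R s (sandwich (fun k => dSym N k s ν * wdSym N k s ν') (fun _ => (1 : ℂ))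
          (balabanFiber N hN a ha s hs hs0).G)‖ ≤ C2op d a / N
    ∧ ‖sandwich (fun _ => (1 : ℂ)) (fun K => dSym (R * N) K s ν * wdSym (R * N) K s ν')
          (balabanFiber (R * N) hRN a ha s hs hs0).G
        - plant R s (sandwich (fun _ => (1 : ℂ)) (fun k => dSym N k s ν * wdSym N k s ν')
          (balabanFiber N hN a ha s hs hs0).G)‖ ≤ C2op d a / N :=
  ⟨orderOneOpRateResidualL_holds d a N R hN hRN ha s hs hs0 ν hR,
   orderOneOpRateResidualR_holds d a N R hN hRN ha s hs hs0 ν hR,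
   opNorm_D_G_DW_rate hN hR hRN a ha hs hs0 ν ν',
   opNorm_DDW_G_rate hN hR hRN a ha hs hs0 ν ν',
   opNorm_G_DDW_rate hN hR hRN a ha hs hs0 ν ν'⟩

end OneSided

/-! ## §6 The REMAINING currency, typed: one King weight per derivative (`W∂_ν ⊗ W∂_{ν′}`, King's `u … ū` placement) [folklore] -/

section SingleWeight

variable {N R : ℕ} [NeZero N] [NeZero R]

/-- the SINGLE-weighted derivative symbol `W·∂^{(n)}_ν(q̃_k)` (one King alias weight (4.20) per derivative
— the placement of King's (4.19), `… G u … ū …`). [cite: King1986, (4.19)–(4.20) p.672] [folklore] -/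
def w1dSym (n : ℕ) (k : Fin d → Fin n) (s : Fin d → ℝ) (ν : Fin d) : ℂ :=
  ((Wc n k s : ℝ) : ℂ) * dSym n k s ν

omit [NeZero N] [NeZero R] in
/-- `Wc·‖q̃_k‖_∞ ≤ π`. [folklore] -/
theorem Wc_mul_norm_le {n : ℕ} (k : Fin d → Fin n) {s : Fin d → ℝ} (hs : ∀ μ, |s μ| ≤ Real.pi) :
    Wc n k s * ‖symmAlias n k s‖ ≤ Real.pi := by
  unfold Wc; rw [symmAlias_eq_aliasPt]
  exact aliasWeight_mul_norm_le hs _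

omit [NeZero N] [NeZero R] in
/-- `|W·∂_ν(q̃)| ≤ π`, uniformly (ONE weight already bounds the derivative symbol). [cite: King1986, (4.20)
p.672] [folklore] -/
theorem norm_w1dSym_le {n : ℕ} (hn : 1 ≤ n) (k : Fin d → Fin n) {s : Fin d → ℝ}
    (hs : ∀ ν, |s ν| ≤ Real.pi) (ν : Fin d) : ‖w1dSym n k s ν‖ ≤ Real.pi := by
  unfold w1dSym
  rw [norm_mul, Complex.norm_real, Real.norm_eq_abs, abs_of_nonneg (Wc_nonneg_le_one k hs).1]
  calc _ ≤ Wc n k s * ‖symmAlias n k s‖ := by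
          gcongr
          · exact (Wc_nonneg_le_one k hs).1
          · exact B5G183RateL2.norm_dSym_le hn k s ν
    _ ≤ Real.pi := Wc_mul_norm_le k hs

/-- **uniform bound in the single-weight currency:** `‖D_{W∂_ν} G(p′) D_{W∂_{ν′}}^*‖ ≤ gamma0 d a` (`W ≤ 1`,
b05's `opNorm_D_G_D_le`). [cite: Balaban1984PropagatorsI, Prop. 1.1 (1.89) p.33] [folklore] -/
theorem opNorm_DW1_G_DW1_le {n : ℕ} [NeZero n] (hn : 1 ≤ n) (a : ℝ) (ha : 0 < a) {s : Fin d → ℝ}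
    (hs : ∀ ν, |s ν| ≤ Real.pi) (hs0 : s ≠ 0) (ν ν' : Fin d) :
    ‖sandwich (fun K => w1dSym n K s ν) (fun K => w1dSym n K s ν') (balabanFiber n hn a ha s hs hs0).G‖
      ≤ gamma0 d a := by
  classical
  have e : sandwich (fun K => w1dSym n K s ν) (fun K => w1dSym n K s ν') (balabanFiber n hn a ha s hs hs0).G
      = sandwich (fun K => ((Wc n K s : ℝ) : ℂ)) (fun K => ((Wc n K s : ℝ) : ℂ))
          (sandwich (fun K => dSym n K s ν) (fun K => dSym n K s ν') (balabanFiber n hn a ha s hs hs0).G) := by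
    ext i j
    simp only [sandwich, w1dSym, map_mul, Complex.conj_ofReal]
    ring
  rw [e]
  have h1 : ∀ K : Fin d → Fin n, ‖(((Wc n K s : ℝ) : ℂ))‖ ≤ 1 := fun K => by
    rw [Complex.norm_real, Real.norm_eq_abs, abs_of_nonneg (Wc_nonneg_le_one K hs).1]
    exact (Wc_nonneg_le_one K hs).2
  calc _ ≤ 1 * ‖sandwich (fun K => dSym n K s ν) (fun K => dSym n K s ν')
              (balabanFiber n hn a ha s hs hs0).G‖ * 1 :=
          opNorm_sandwich_le zero_le_one zero_le_one h1 h1 _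
    _ ≤ 1 * gamma0 d a * 1 := by gcongr; exact opNorm_D_G_D_le n hn a ha s hs hs0 ν ν'
    _ = gamma0 d a := by ring

/-- **TYPED RESIDUAL — the one remaining order-two currency; NOT PROVED in this package and NOT a hypothesis
of any theorem in this package.** One King weight per derivative (King's own placement `u … ū` in (4.19)),
exponent `γ`: `‖D_{W∂^{(RN)}_ν} F_{RN} D_{W∂^{(RN)}_{ν′}}^* − plant_R(D_{W∂^{(N)}_ν} F_N D_{W∂^{(N)}_{ν′}}^*)‖ ≤
C/N^γ`. KNOWN HERE: (i) the uniform bound (`opNorm_DW1_G_DW1_le`); (ii) its free-diagonal SYMBOL has the full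
rate `γ = 1` (`B5G183RateO2Diag.diag_weight2_rate_le`, `opNorm_Dg2_le`); (iii) with `W²` instead of `W` on
one side and none on the other it holds with `γ = 1` (`orderTwoOpRateResidualW_holds`); (iv) with no weight
it is false for every `C` at `γ = 1` (`B5G183RateObstructionOp.no_orderTwoOpRate`). NOT REACHED by the soft
algebra of §4: the replacement `∂^{(RN)}_{ν′} → ∂^{(N)}_{ν′}` costs `6‖q̃‖²/N` on the far paired classes and
one weight pays one power only (`Wc_mul_norm_le`); the finite-rank blocks need the two-sided entrywise decay
of `B5G183RateL2Op` §3–§3d. The exponent `γ ∈ (0,1]` it allows is King's printed trade «α + γ < 1»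
((4.23) p.672). [cite: Balaban1984PropagatorsI, Prop. 1.1 (1.89) p.33; King1986, (4.19)–(4.20), (4.23)
p.672] [folklore] -/
def OrderTwoOpRateResidualW1 (d : ℕ) (a C γ : ℝ) : Prop :=
  ∀ (N R : ℕ) [NeZero N] [NeZero R] (hN : 1 ≤ N) (hRN : 1 ≤ R * N) (ha : 0 < a) (s : Fin d → ℝ)
    (hs : ∀ ν, |s ν| ≤ Real.pi) (hs0 : s ≠ 0) (ν ν' : Fin d), 1 ≤ R →
    ‖sandwich (fun K => w1dSym (R * N) K s ν) (fun K => w1dSym (R * N) K s ν')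
          (balabanFiber (R * N) hRN a ha s hs hs0).G
        - plant R s (sandwich (fun k => w1dSym N k s ν) (fun k => w1dSym N k s ν')
          (balabanFiber N hN a ha s hs hs0).G)‖
      ≤ C / (N : ℝ) ^ γ

omit [NeZero N] [NeZero R] in
/-- the residual is MONOTONE in the exponent: a rate `N^{−γ}` gives every smaller rate `N^{−γ′}`, `γ′ ≤ γ`
(bookkeeping only; `N ≥ 1`). [folklore] -/
theorem orderTwoOpRateResidualW1_mono {d : ℕ} {a C γ γ' : ℝ} (hC : 0 ≤ C) (hγ : γ' ≤ γ)
    (h : OrderTwoOpRateResidualW1 d a C γ) : OrderTwoOpRateResidualW1 d a C γ' := by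
  intro N R _ _ hN hRN ha s hs hs0 ν ν' hR
  have hN1 : (1 : ℝ) ≤ N := by exact_mod_cast hN
  calc _ ≤ C / (N : ℝ) ^ γ := h N R hN hRN ha s hs hs0 ν ν' hR
    _ ≤ C / (N : ℝ) ^ γ' := by
        apply div_le_div_of_nonneg_left hC (Real.rpow_pos_of_pos (by linarith) _)
        exact Real.rpow_le_rpow_of_exponent_le hN1 hγ

end SingleWeight

end Literature.MathematicalPhysics.QuantumFieldTheory.Balaban1983to89.B5G183RateO2Op
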